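import Literature.Probability.RandomPlanarGeometry.SLE
import Literature.Probability.RandomPlanarGeometry.CurveSpace
import Literature.Probability.RandomPlanarGeometry.CritPercSLESwallowedProofs
import Literature.Probability.RandomPlanarGeometry.ConformalRestrictionProofs
import Literature.Probability.RandomPlanarGeometry.LoewnerDescriptionProofs
import Literature.Probability.RandomPlanarGeometry.StoppedCompactifiedImage
import HarnessLib

/-!
# A fixed point is almost surely not on the chordal SLE_κ curve, `4 < κ < 8` (law level)

Topic `Probability/RandomPlanarGeometry`; theorems only. Rohde–Schramm's "for every
`z ∈ closure ℍ`, a.s. `z ∉ γ[0, ∞)`" (`ae_notMem_range_sleTrace`, `4 < κ < 8`) transported to the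
law of chordal SLE_κ in a Dobrushin domain `(D; a, b)`: for every fixed point `w ≠ a, b`,
`μ`-a.e. curve class does not pass through `w` (`IsSLELaw.ae_notMem_range`). (The points `a`, `b`
are the endpoints of every curve.) The event `{γ | w ∈ γ.range}` is Borel
(`CurveClass.measurableSet_setOf_mem_range`: its complement is the countable union of the closed
events `rangeSubset {z | 1/(n+1) ≤ dist z w}`).

Consequence (regularity of the SLE₆ family for the refutation of crux
`stmt-CriticalPhenomena-0698`): the range of the SLE₆ curve a.s. contains no sub-arc of any FIXED
curve, in particular no segment of a fixed line (`IsSLELaw.ae_not_subset_range`).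

References: S. Rohde, O. Schramm, *Basic properties of SLE*, Ann. of Math. 161 (2005), Thm. 6.4.
-/

noncomputable section

open Set Filter Topology MeasureTheory Metric

open scoped NNReal unitInterval

namespace Literature.Probability.RandomPlanarGeometry

/-! ### The event `{w ∈ range}` is Borel -/

/-- Curve classes avoiding the point `w` form a countable union of closed `rangeSubset` events.
[folklore] -/
theorem CurveClass.setOf_notMem_range_eq (w : ℂ) :
    {γ : CurveClass ℂ | w ∉ γ.range} =
      ⋃ n : ℕ, CurveClass.rangeSubset {z : ℂ | 1 / ((n : ℝ) + 1) ≤ dist z w} := by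
  ext γ
  simp only [mem_setOf_eq, mem_iUnion, CurveClass.mem_rangeSubset]
  constructor
  · intro hw
    have hc : IsCompact γ.range := γ.isCompact_range
    have hpos : 0 < infDist w γ.range :=
      (hc.isClosed.notMem_iff_infDist_pos γ.range_nonempty).1 hw
    obtain ⟨n, hn⟩ := exists_nat_one_div_lt hpos
    refine ⟨n, fun z hz ↦ ?_⟩
    rw [mem_setOf_eq, dist_comm]
    exact hn.le.trans (infDist_le_dist_of_mem hz)
  · rintro ⟨n, hn⟩ hw
    have h := hn hw
    rw [mem_setOf_eq, dist_self] at h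
    exact absurd h (not_le.2 (by positivity))

/-- **`{γ | w ∈ γ.range}` is Borel.** [folklore] -/
theorem CurveClass.measurableSet_setOf_mem_range (w : ℂ) :
    MeasurableSet {γ : CurveClass ℂ | w ∈ γ.range} := by
  have h : MeasurableSet {γ : CurveClass ℂ | w ∉ γ.range} := by
    rw [CurveClass.setOf_notMem_range_eq]
    exact MeasurableSet.iUnion fun n ↦ CurveClass.measurableSet_rangeSubset
      (isClosed_le continuous_const (continuous_id.dist continuous_const))
  convert h.compl using 1
  ext γ
  simp

/-! ### The law-level statement -/

variable {κ : ℝ≥0} {D : DobrushinDomain}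

/-- The range of a compactified image: `Φ(γ[0, ∞)) ∪ {b}`. [folklore] -/
theorem IsCompactifiedImage.range_subset_image_union {Φ : ℂ → ℂ} {γ : ℝ≥0 → ℂ} {b : ℂ} {c : Curve ℂ}
    (h : IsCompactifiedImage Φ γ b c) : c.range ⊆ Φ '' range γ ∪ {b} := by
  intro w hw
  obtain ⟨s, rfl⟩ := Curve.mem_range.1 hw
  rcases lt_or_eq_of_le s.2.2 with hs | hs
  · exact Or.inl ⟨γ (rayParam s), ⟨_, rfl⟩, (h.1 s hs).symm⟩
  · have : s = 1 := Subtype.ext hs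
    rw [this]
    exact Or.inr h.2

/-- **A fixed point `w ≠ a, b` is a.s. not on the chordal SLE_κ curve, `4 < κ < 8`** (random curve
level). [cite: RohdeSchramm2005, Thm 6.4] -/
theorem IsSLECurve.ae_notMem_range (hκ4 : 4 < κ) (hκ8 : κ < 8) {Γ : (ℝ≥0 → ℝ) → CurveClass ℂ}
    (hΓ : IsSLECurve κ D Γ) {w : ℂ} (hwa : w ≠ D.pt 0) (hwb : w ≠ D.pt 1) :
    ∀ᵐ ω ∂Process.preWienerMeasure, w ∉ (Γ ω).range := by
  classical
  obtain ⟨-, φ, hφ, hae⟩ := hΓ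
  set Φ : ℂ → ℂ := φ.boundaryExtension with hΦdef
  -- the (at most one) preimage of `w` in the closed half-plane
  by_cases hpre : ∃ z : ℂ, 0 ≤ z.im ∧ Φ z = w
  · obtain ⟨z, hzim, hzw⟩ := hpre
    have hz0 : z ≠ 0 := by
      rintro rfl
      exact hwa (hzw ▸ hφ.boundaryExtension_zero)
    filter_upwards [hae, ae_notMem_range_sleTrace hκ4 hκ8 hzim hz0] with ω hω hnot hmem
    obtain ⟨hgen, c₀, hc₀, himg⟩ := hω
    rw [hc₀, CurveClass.range_mk] at hmem
    rcases himg.range_subset_image_union hmem with ⟨y, hy, hyw⟩ | hb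
    · apply hnot
      have hyim : 0 ≤ y.im := by
        obtain ⟨τ, rfl⟩ := hy
        exact hgen.im_nonneg τ
      have : y = z := JordanDomain.injOn_boundaryExtension φ hyim hzim (hyw.trans hzw.symm)
      exact this ▸ hy
    · exact hwb hb
  · filter_upwards [hae] with ω hω hmem
    obtain ⟨hgen, c₀, hc₀, himg⟩ := hω
    rw [hc₀, CurveClass.range_mk] at hmem
    rcases himg.range_subset_image_union hmem with ⟨y, hy, hyw⟩ | hb
    · obtain ⟨τ, rfl⟩ := hy
      exact hpre ⟨_, hgen.im_nonneg τ, hyw⟩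
    · exact hwb hb

/-- **A fixed point `w ≠ a, b` is a.s. not on the chordal SLE_κ curve, `4 < κ < 8`** (law level).
[cite: RohdeSchramm2005, Thm 6.4] -/
theorem IsSLELaw.ae_notMem_range (hκ4 : 4 < κ) (hκ8 : κ < 8) {μ : Measure (CurveClass ℂ)}
    (hμ : IsSLELaw κ D μ) {w : ℂ} (hwa : w ≠ D.pt 0) (hwb : w ≠ D.pt 1) :
    ∀ᵐ γ ∂μ, w ∉ γ.range := by
  obtain ⟨Γ, hΓ, rfl⟩ := hμ
  exact (ae_map_iff hΓ.1 (CurveClass.measurableSet_setOf_mem_range w).compl).2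
    (hΓ.ae_notMem_range hκ4 hκ8 hwa hwb)

/-- **The range of the SLE_κ curve a.s. does not contain a fixed set having a point off `{a, b}`**
(e.g. a fixed segment or arc): for `S ∋ w`, `w ≠ a, b`, `μ`-a.e. `S ⊄ γ.range`.
[cite: RohdeSchramm2005, Thm 6.4] -/
theorem IsSLELaw.ae_not_subset_range (hκ4 : 4 < κ) (hκ8 : κ < 8) {μ : Measure (CurveClass ℂ)}
    (hμ : IsSLELaw κ D μ) {S : Set ℂ} {w : ℂ} (hwS : w ∈ S) (hwa : w ≠ D.pt 0) (hwb : w ≠ D.pt 1) :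
    ∀ᵐ γ ∂μ, ¬ S ⊆ γ.range := by
  filter_upwards [hμ.ae_notMem_range hκ4 hκ8 hwa hwb] with γ hγ hsub
  exact hγ (hsub hwS)

end Literature.Probability.RandomPlanarGeometry

end
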